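import Mathlib.LinearAlgebra.Matrix.GeneralLinearGroup.Defs
import Mathlib.Algebra.Group.Pi.Units
import Mathlib.Data.ZMod.Units
import Mathlib.NumberTheory.ModularForms.CongruenceSubgroups
import Literature.NumberTheory.Automorphic.ArithmeticQuotientCohomology
import HarnessLib

/-!
# Torsion Hecke eigensystems: Hecke eigenclasses in `H^i(Γ₁(N) ⊂ SL_n(ℤ), A)` for a finite ring `A`

Topic `NumberTheory/Automorphic`, namespace `Literature.NumberTheory.Automorphic` (vocabulary for
congruence subgroups of `SL_n(ℤ)` and their Hecke modules under `Literature.NumberTheory.Automorphic.SLn`).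

This file types the objects of

* A. Ash, P. Gunnells, M. McConnell, *Torsion in the cohomology of congruence subgroups of
  `SL(4, ℤ)` and Galois representations*, J. Algebra 325 (2011) 404–415 = arXiv:1002.3385, §§2–3
  (read: pp. 1–8 of the arXiv version) [AshGunnellsMcconnell2011],

namely *systems of Hecke eigenvalues with values in a ring `A` (in the applications `A = ℤ/p^mℤ`
or `𝒪/ϖ^m`) occurring in the group cohomology `H^i(Γ, A)` of a congruence subgroup
`Γ = Γ₁(N)` (or `Γ₀(N)`) of `SL_n(ℤ)`, for the double-coset operators `T(ℓ, k)`, `ℓ ∤ N` prime,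
`0 ≤ k ≤ n`*, as definitions with bodies (`TorsionHeckeEigensystem`,
`TorsionHeckeEigensystem.Occurs`).  It is a DEFINITION file: nothing here is a named fact or an
open problem; the conjecture of the source (Conj. 5: attached Galois representations) is not stated.

## The printed definitions ([AshGunnellsMcconnell2011, §3])

> Let `Γ₀(N)` be the subgroup of matrices in `SL(m, ℤ)` whose first row is congruent to
> `(*, 0, …, 0)` modulo `N`.  Define `S_N` to be the subsemigroup of integral matrices in `GL(m, ℚ)`
> satisfying the same congruence condition and having positive determinant relatively prime to `N`.
> `ℋ(N)` = the `ℤ`-algebra of double cosets `Γ₀(N) S_N Γ₀(N)`; it acts on the cohomology and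
> homology of `Γ₀(N)` with coefficients in any `ℤ[S_N]`-module. `ℋ(N)` contains the double cosets
> `Γ₀(N) D(ℓ,k) Γ₀(N)`, `ℓ ∤ N` prime, `0 ≤ k ≤ m`, `D(ℓ,k) = diag(1,…,1,ℓ,…,ℓ)` (`k` entries `ℓ`);
> as a Hecke operator it is called `T(ℓ,k)`.
> **Definition 4.** Let `A` be a ring and `V` an `ℋ(N) ⊗ A`-module. Suppose `v ∈ V` is a
> simultaneous eigenvector for all `T(ℓ,k)` and that `T(ℓ,k) v = a(ℓ,k) v` with `a(ℓ,k) ∈ A` for all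
> prime `ℓ ∤ N` and all `0 ≤ k ≤ m`. [Then `ρ : G_ℚ → GL(m, A)` unramified outside `LN` with
> `∑_k (-1)^k ℓ^{k(k-1)/2} a(ℓ,k) X^k = det(I - ρ(Frob_ℓ) X)` for `ℓ ∤ LN` is *attached* to `v`.]
> (§2: "if `M` is any `S`-module, `ℋ` acts naturally on `H_*(Γ, M)` and `H^*(Γ, M)`. The action is
> given by composing a twisted restriction map with a corestriction map.")

The companion paper [AshGunnellsMcconnell2002, §1.2] (J. Number Theory 94) defines `Γ₀(N)` by
"last row congruent to `(0, …, 0, *)`" (the two conventions are conjugate under the antidiagonal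
permutation matrix) and lets `Γ D(l,k) Γ = ∐_{g ∈ Ω} Γ g` act on (sharbly) homology by
`T(l,k) ξ = ∑_{g ∈ Ω} g · ξ` [AshGunnellsMcconnell2002, §2.6].

## How the objects are typed (all by in-tree / Mathlib definitions)

* `SLn.Gamma0 n N`, `SLn.Gamma1 n N ≤ SL(n, ℤ)`: **last row** `≡ (0,…,0,*)`, resp. `≡ (0,…,0,1)`
  modulo `N` (the convention of [AshGunnellsMcconnell2002, §1.2] and, for `n = 2`, of Mathlib and
  [DiamondShurman2005, §5.2]: `SLn.Gamma0_two`, `SLn.Gamma1_two` identify them with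
  `CongruenceSubgroup.Gamma0 N`, `CongruenceSubgroup.Gamma1 N`).
* `H^i(Γ, A)` for `Γ ≤ SL_n(ℤ)` and a commutative ring `A` (trivial action) is
  `SLn.cohomology n Γ A i := ArithmeticQuotient.cohomology A (id : GL_n(ℚ) →* GL_n(ℚ)) Γ A i`
  `= H^i(GL_n(ℚ), Fun(GL_n(ℚ) ⧸ Γ, A))` (`Literature.NumberTheory.Automorphic.ArithmeticQuotientCohomology`,
  Mathlib `groupCohomology`; `Γ` is viewed in `GL_n(ℚ)` through `SL(n, ℤ) →* GL_n(ℚ)`), which is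
  `H^i(Γ, A)` by Shapiro's lemma (`Fun(GL_n(ℚ) ⧸ Γ, A)` is the co-induced module of the trivial
  `Γ`-module `A`; Mathlib `groupCohomology.coindIso`).  This is the device of the tree's adelic
  Hecke modules (`Ash2003.cohomology`, `HeckeEigenvaluesOccurGL`, `BigHeckeGLn.levelCohomology`)
  with `GL_n(𝔸_f)` replaced by `GL_n(ℚ)`; it makes the Hecke operators elementary:
* for `g ∈ GL_n(ℚ)` the **Hecke operator** `T_g = [Γ g Γ]` on `H^i(Γ, A)` is `SLn.heckeOp`, the
  tree's `ArithmeticQuotient.heckeEnd`: on coefficients `(T_g f)(xΓ) = ∑_{hΓ ⊆ ΓgΓ} f(x h Γ)` (a finite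
  sum, `Γ` and `gΓg⁻¹` being commensurable), transported to `H^i` by functoriality.  Unwinding
  Shapiro's lemma (not formalised here): `T_g = cores_{Γ ∩ gΓg⁻¹}^{Γ} ∘ (g·)_* ∘ res^{Γ}_{Γ ∩ g⁻¹Γg}`
  (restriction; the isomorphism induced by `x ↦ g x g⁻¹ : Γ ∩ g⁻¹Γg → Γ ∩ gΓg⁻¹` and translation of
  coefficients by `g`; corestriction) — the double coset `ΓgΓ` acting by "twisted restriction and
  corestriction" for coefficients on which `GL_n(ℚ)` acts on the LEFT, in degree `0`
  `c ↦ ∑_{hΓ ⊆ ΓgΓ} h · c`; on `Γ`-invariant functions `F` on a left `GL_n(ℚ)`-set,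
  `(T_g F)(y) = ∑_{hΓ ⊆ ΓgΓ} F(h⁻¹ y) = ∑_{Γβ ⊆ Γg⁻¹Γ} F(β y)`, i.e. `T_g = τ_{g⁻¹}` for the operator
  `τ_α : F ↦ ∑_{Γβ ⊆ ΓαΓ} F(β ·)` of modular forms (`f[ΓαΓ]_k = ∑_j f[β_j]_k`, `ΓαΓ = ∪ Γβ_j`,
  [DiamondShurman2005, Def. 5.1.3]; [ShimuraIATAF1971, §3.4]).  Relation to the source: the recipe
  "transfer, translation by `s`, corestriction" on HOMOLOGY with left coefficients is
  `ξ ↦ ∑_{Γg ⊆ ΓsΓ} g · ξ`, the formula of [AshGunnellsMcconnell2002, §2.6]; the same recipe on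
  cohomology is the present `T_s`, while the ADJOINT of the homology operator (for the duality with
  cohomology) is `T_{s⁻¹} = T_{det(s) s⁻¹}` (central elements of `GL_n(ℚ)` act trivially on `H^i`).
  The two readings of "`T(ℓ,k)` on `H^i`" differ, up to the centre and diamond operators, by
  `k ↔ n - k` (`ρ ↔ ρ^∨ ⊗ ε^{n-1}` up to the nebentype on the Galois side of Def. 4); this file fixes
  the first, which for `n = 2` reproduces [DiamondShurman2005, §5.2] on the nose
  (next two items), and leaves the normalisation of the Galois side to the statement that uses it
  (cf. the tree's `Ash2003.IsAttached`, arithmetic Frobenius with the representatives `E(ℓ,k)` below).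
  It is also, verbatim, the formula by which the tree lets `[K g K]` act adelically
  (`ArithmeticQuotient.heckeFun`), so that under `GL_n(𝔸_f) = GL_n(ℚ) · K₁(N)` (strong approximation)
  the present `T_g`, `g ∈ GL_n(ℚ)`, is the adelic `[K₁(N) g K₁(N)]`.
* `T(ℓ, k) := T_{E(ℓ,k)}` (`SLn.heckeT`) with `E(ℓ,k) = diag(ℓ,…,ℓ,1,…,1)`, **`k` entries `ℓ` first**
  (`SLn.heckeMatrix`; the representative of the tree's `Ash2003.heckeElement` and `heckeDiagAt`; it has
  the elementary divisors of the source's `D(ℓ,k)` and, for `k < n`, last row `(0,…,0,1)`, so that it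
  lies in the Hecke semigroup `{last row ≡ (0,…,0,1) mod N}` of `Γ₁(N)`).  `T(ℓ, 0) = 1`
  (`SLn.heckeT_zero`).  For `n = 2`: `T(p, 1) = T_{diag(p,1)} = τ_{diag(1,p)}` is the operator
  `T_p = [Γ₁(N) (1 0; 0 p) Γ₁(N)]` of [DiamondShurman2005, §5.2] (on trivial coefficients).
* the **diamond operators** `⟨d⟩ := T_{γ_d⁻¹} = τ_{γ_d}` on `H^i(Γ₁(N), A)`, `d ∈ (ℤ/N)^×`, with
  `γ_d ∈ Γ₀(N)` any element with lower-right entry `≡ d` (`SLn.diamondRep`, chosen by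
  `Classical.epsilon`; it exists for `n ≥ 2`, `SLn.exists_diamondRep`, and the operator does not
  depend on the choice, `SLn.diamondOp_eq_heckeOp`, because `T_g` only depends on `ΓgΓ`,
  `ArithmeticQuotient.heckeEnd_coe_mul_mul_coe`): the action of
  `Γ₀(N)/Γ₁(N) ≅ (ℤ/N)^×`, for `n = 2` exactly `⟨d⟩ f = f[α]_k`, `α ∈ Γ₀(N)`, `δ ≡ d`, of
  [DiamondShurman2005, §5.2].  For `Γ₁(N)` the element of the source's type `(ℓ,…,ℓ)` inside the
  `Γ₁(N)`-semigroup is `ℓ γ_{ℓ⁻¹}`, whose operator is `⟨ℓ⟩ ∘ T(ℓ, n)` (and `T(ℓ,n) = T_{ℓ·1}` acts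
  trivially); this is why an eigensystem for `Γ₁(N)` records the nebentype `ε` as well (for `n = 2`
  the familiar `1 - a_p X + p ε(p) X²`).
* **Definition 4** becomes `TorsionHeckeEigensystem n N A i S`: a class `c ∈ H^i(Γ₁(N), A)` with
  `T(ℓ,k) c = a(ℓ,k) • c` for all primes `ℓ ∤ N`, `ℓ ∉ S` (`S` a finite set of neglected primes, `∅`
  in the source) and `0 ≤ k ≤ n`, and `⟨d⟩ c = ε(d) • c`; and the proposition
  `TorsionHeckeEigensystem.Occurs n N A i S a ε` that given values `a`, `ε` so occur.
  **Non-degeneracy.** The source asks for an eigen*vector* (`v ≠ 0`).  With torsion coefficients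
  `A = ℤ/p^m` a non-zero `p`-torsion eigenclass only determines its eigenvalues modulo `p`, so that
  "the `ℤ/p^m`-valued system `a` occurs" would be implied by "`a mod p` occurs".  We therefore ask the
  eigenclass to be **faithful**: `r • c = 0 → r = 0` for `r ∈ A` (its annihilator vanishes; `A → H^i`,
  `r ↦ r • c` is injective; for `A = ℤ/p^m`: `c` has exact order `p^m`).  For a field `A` this is
  just `c ≠ 0` (`SLn.faithful_iff_ne_zero`), so for `A = 𝔽̄_p` the notion is literally Definition 4
  (and [AshGunnellsMcconnell2002, Def. 1] over `ℂ`).  A faithful eigenclass makes `T(ℓ,k) ↦ a(ℓ,k)`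
  extend to an `A`-algebra homomorphism `𝕋 → A` of the Hecke algebra `𝕋 ⊆ End_A H^i(Γ₁(N), A)`
  generated by the operators (the weaker, Hecke-algebra sense of "occurs", [Scholze2015, §V.4,
  `𝕋_{F,S}(K, ξ, i, m)`]; [CalegariEmerton2011, §1]); the converse fails in general.

What is NOT here: the comparison isomorphism with Mathlib's `groupCohomology (Rep.trivial A Γ A)`
(Shapiro) and with restriction/corestriction as morphisms; the fact that `T_{zg} = T_g` on `H^i` for
central `z ∈ GL_n(ℚ)` (inner automorphisms act trivially), in particular that `T(ℓ,n) = T_{ℓ·1}` is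
the identity; commutativity of the operators; the Galois side (Def. 4, second half; Conj. 5), for which see the tree's
`Ash2003.IsAttached`, `heckeFrobPoly`, `scholzeHeckePolynomial`.

## References

* A. Ash, P. E. Gunnells, M. McConnell, *Torsion in the cohomology of congruence subgroups of
  SL(4, ℤ) and Galois representations*, J. Algebra 325 (2011), 404–415; arXiv:1002.3385, §2, §3,
  Definition 4, Conjecture 5 [AshGunnellsMcconnell2011].
* A. Ash, P. E. Gunnells, M. McConnell, *Cohomology of congruence subgroups of SL₄(ℤ)*, J. Number
  Theory 94 (2002), 181–212; arXiv:math/0003219, §1.1 (Def. 1), §1.2 (`Γ₀(N)`: last row), §2.6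
  (`T(l,k) ξ = ∑_{Γg ⊆ Γ D(l,k) Γ} g·ξ` on sharbly homology) [AshGunnellsMcconnell2002].
* P. Scholze, *On torsion in the cohomology of locally symmetric varieties*, Ann. of Math. 182
  (2015), §V.4 (the convention `H^i(X_K, ·)` followed by `ArithmeticQuotient.cohomology`) [Scholze2015].
* F. Diamond, J. Shurman, *A first course in modular forms*, GTM 228 (2005), Def. 5.1.3, §5.2
  (`Γ₁(N) ◁ Γ₀(N)`, `⟨d⟩`, `T_p`) [DiamondShurman2005].
* G. Shimura, *Introduction to the arithmetic theory of automorphic functions* (1971), Ch. 3, §8.3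
  [ShimuraIATAF1971].
* F. Calegari, M. Emerton, *Completed cohomology — a survey* (2012), §1 [CalegariEmerton2011].
-/

noncomputable section

open scoped MatrixGroups
open CategoryTheory Matrix

universe u

namespace Literature.NumberTheory.Automorphic

/-! ### Hecke operators only depend on the double coset (complement to `ArithmeticQuotient`) -/

namespace ArithmeticQuotient

variable (k : Type u) [CommRing k] {Γ 𝒢 : Type u} [Group Γ] [Group 𝒢] (L : Subgroup 𝒢)

omit [Group Γ] in
variable {k} in
/-- `L (l₁ g l₂) L / L = L g L / L` for `l₁, l₂ ∈ L`: the double coset, viewed in `𝒢 ⧸ L`, only depends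
on the double coset. [folklore] -/
theorem doubleCosetQuot_coe_mul_mul_coe (g : 𝒢) (l₁ l₂ : L) :
    doubleCosetQuot L ((l₁ : 𝒢) * g * l₂) = doubleCosetQuot L g := by
  have h : (((l₁ : 𝒢) * g * l₂ : 𝒢) : 𝒢 ⧸ L) = l₁ • (g : 𝒢 ⧸ L) := by
    rw [QuotientGroup.mk_mul_of_mem _ l₂.2]
    rfl
  rw [doubleCosetQuot, doubleCosetQuot, h]
  exact MulAction.orbit_smul l₁ (g : 𝒢 ⧸ L)

variable (M : Type u) [AddCommGroup M] [Module k M]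

omit [Group Γ] in
variable {L} in
/-- The Hecke operator `[L g L]` on functions only depends on `L g L / L`. [folklore] -/
theorem heckeFun_congr {g g' : 𝒢} (h : doubleCosetQuot L g' = doubleCosetQuot L g) :
    heckeFun k L g' M = heckeFun k L g M := by
  refine LinearMap.ext fun f => funext fun c => ?_
  rw [heckeFun_apply, heckeFun_apply]
  have h' : (doubleCosetQuot L g').Finite ↔ (doubleCosetQuot L g).Finite := by rw [h]
  by_cases h₁ : (doubleCosetQuot L g').Finite
  · rw [dif_pos h₁, dif_pos (h'.mp h₁)]
    refine Finset.sum_congr (Finset.ext fun d => ?_) fun _ _ => rfl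
    rw [Set.Finite.mem_toFinset, Set.Finite.mem_toFinset, h]
  · rw [dif_neg h₁, dif_neg (fun h₂ => h₁ (h'.mpr h₂))]

variable (ι : Γ →* 𝒢)

variable {L} in
/-- The Hecke operator `T_g` on `H^i(X_L, M)` only depends on `L g L / L`, in particular only on the
double coset `L g L` (`doubleCosetQuot_coe_mul_mul_coe`). [folklore] -/
theorem heckeEnd_congr {g g' : 𝒢} (h : doubleCosetQuot L g' = doubleCosetQuot L g) (i : ℕ) :
    heckeEnd k L g' M ι i = heckeEnd k L g M ι i := by
  have hrep : heckeRepHom k L g' M ι = heckeRepHom k L g M ι := by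
    refine Rep.hom_ext (Representation.IntertwiningMap.ext ?_)
    exact heckeFun_congr k M h
  exact congrArg (fun φ => (groupCohomology.map (MonoidHom.id Γ) φ i).hom) hrep

/-- `T_{l₁ g l₂} = T_g` on `H^i(X_L, M)` for `l₁, l₂ ∈ L`. [folklore] -/
theorem heckeEnd_coe_mul_mul_coe (g : 𝒢) (l₁ l₂ : L) (i : ℕ) :
    heckeEnd k L ((l₁ : 𝒢) * g * l₂) M ι i = heckeEnd k L g M ι i :=
  heckeEnd_congr k M ι (doubleCosetQuot_coe_mul_mul_coe L g l₁ l₂) i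

end ArithmeticQuotient

namespace SLn

/-! ### Congruence subgroups `Γ₀(N)`, `Γ₁(N)` of `SL_n(ℤ)` -/

section Level

variable (n N : ℕ)

/-- Reduction modulo `N`, `SL_n(ℤ) →* SL_n(ℤ/Nℤ)` (Mathlib `Matrix.SpecialLinearGroup.map` of
`ℤ → ℤ/Nℤ`). [folklore] -/
abbrev reduceMod : SL(n, ℤ) →* SL(n, ZMod N) :=
  Matrix.SpecialLinearGroup.map (Int.castRingHom (ZMod N))

/-- Entries of the reduction are the reduced entries. [folklore] -/
@[simp]
theorem reduceMod_apply (γ : SL(n, ℤ)) (i j : Fin n) :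
    (reduceMod n N γ : Matrix (Fin n) (Fin n) (ZMod N)) i j = ((γ i j : ℤ) : ZMod N) :=
  rfl

/-- **`Γ₀(N) ≤ SL_n(ℤ)`**: the matrices whose last row is congruent to `(0, …, 0, *)` modulo `N`
(`SLn.mem_Gamma0_iff`), i.e. which fix the line of the row vector `e_n = (0,…,0,1)` modulo `N`
(`e_n γ ≡ u e_n`).  Convention of [AshGunnellsMcconnell2002, §1.2] ("last row congruent to
`(0,…,0,*)`"; [AshGunnellsMcconnell2011, §3] uses the first row and `(*,0,…,0)`, a conjugate); for
`n = 2` it is Mathlib's `CongruenceSubgroup.Gamma0 N` (`SLn.Gamma0_two`).  For `n = 0` (no last row)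
it is everything. [cite: AshGunnellsMcconnell2002, §1.2] -/
def Gamma0 : Subgroup SL(n, ℤ) where
  carrier := {γ | ∀ i : Fin n, (i : ℕ) + 1 = n → ∃ u : ZMod N,
    Pi.single i (1 : ZMod N) ᵥ* (reduceMod n N γ : Matrix (Fin n) (Fin n) (ZMod N)) =
      u • Pi.single i (1 : ZMod N)}
  one_mem' := by
    intro i _
    refine ⟨1, ?_⟩
    rw [map_one, Matrix.SpecialLinearGroup.coe_one, Matrix.vecMul_one, one_smul]
  mul_mem' := by
    intro γ δ hγ hδ i hi
    obtain ⟨u, hu⟩ := hγ i hi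
    obtain ⟨u', hu'⟩ := hδ i hi
    refine ⟨u * u', ?_⟩
    rw [map_mul, Matrix.SpecialLinearGroup.coe_mul, ← Matrix.vecMul_vecMul, hu, Matrix.smul_vecMul,
      hu', smul_smul]
  inv_mem' := by
    intro γ hγ i hi
    obtain ⟨u, hu⟩ := hγ i hi
    set w := Pi.single i (1 : ZMod N) ᵥ* (reduceMod n N γ⁻¹ : Matrix (Fin n) (Fin n) (ZMod N))
      with hw
    have key : u • w = Pi.single i 1 := by
      rw [hw, ← Matrix.smul_vecMul, ← hu, Matrix.vecMul_vecMul, ← Matrix.SpecialLinearGroup.coe_mul,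
        ← map_mul, mul_inv_cancel, map_one, Matrix.SpecialLinearGroup.coe_one, Matrix.vecMul_one]
    refine ⟨w i, funext fun j => ?_⟩
    have hi1 : u * w i = 1 := by simpa using congrFun key i
    have hj : u * w j = (Pi.single i (1 : ZMod N) : Fin n → ZMod N) j := by
      simpa only [Pi.smul_apply, smul_eq_mul] using congrFun key j
    rw [Pi.smul_apply, smul_eq_mul]
    calc w j = (w i * u) * w j := by rw [mul_comm (w i) u, hi1, one_mul]
      _ = w i * (u * w j) := by ring
      _ = w i * (Pi.single i (1 : ZMod N) : Fin n → ZMod N) j := by rw [hj]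

variable {n N} in
/-- Unfolding lemma for `Gamma0`. [folklore] -/
theorem mem_Gamma0_def {γ : SL(n, ℤ)} :
    γ ∈ Gamma0 n N ↔ ∀ i : Fin n, (i : ℕ) + 1 = n → ∃ u : ZMod N,
      Pi.single i (1 : ZMod N) ᵥ* (reduceMod n N γ : Matrix (Fin n) (Fin n) (ZMod N)) =
        u • Pi.single i (1 : ZMod N) :=
  Iff.rfl

variable {n N} in
/-- `γ ∈ Γ₀(N)` iff the off-diagonal entries of its last row are `≡ 0 (mod N)`. [folklore] -/
theorem mem_Gamma0_iff {γ : SL(n, ℤ)} :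
    γ ∈ Gamma0 n N ↔
      ∀ i : Fin n, (i : ℕ) + 1 = n → ∀ j : Fin n, j ≠ i → ((γ i j : ℤ) : ZMod N) = 0 := by
  rw [mem_Gamma0_def]
  constructor
  · intro h i hi j hj
    obtain ⟨u, hu⟩ := h i hi
    have := congrFun hu j
    rw [Matrix.single_one_vecMul, Matrix.row_apply, Pi.smul_apply, Pi.single_eq_of_ne hj,
      smul_zero] at this
    exact this
  · intro h i hi
    refine ⟨((γ i i : ℤ) : ZMod N), funext fun j => ?_⟩
    rw [Matrix.single_one_vecMul, Matrix.row_apply, Pi.smul_apply, smul_eq_mul]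
    by_cases hj : j = i
    · subst hj
      rw [Pi.single_eq_same, mul_one]
      rfl
    · rw [Pi.single_eq_of_ne hj, mul_zero]
      exact h i hi j hj

/-- **`Γ₁(N) ≤ SL_n(ℤ)`**: the matrices whose last row is congruent to `(0, …, 0, 1)` modulo `N`
(`SLn.mem_Gamma1_iff`), i.e. the stabiliser of the row vector `e_n` modulo `N` (`e_n γ ≡ e_n`), the
subgroup of `Γ₀(N)` on which the character `γ ↦ γ_{nn} mod N` is trivial.  For `n = 2` it is
Mathlib's `CongruenceSubgroup.Gamma1 N` = [DiamondShurman2005, §5.1] (`SLn.Gamma1_two`).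
[cite: DiamondShurman2005, §5.1 (n = 2); AshGunnellsMcconnell2002, §1.2 (convention)] -/
def Gamma1 : Subgroup SL(n, ℤ) where
  carrier := {γ | ∀ i : Fin n, (i : ℕ) + 1 = n →
    Pi.single i (1 : ZMod N) ᵥ* (reduceMod n N γ : Matrix (Fin n) (Fin n) (ZMod N)) =
      Pi.single i (1 : ZMod N)}
  one_mem' := by
    intro i _
    rw [map_one, Matrix.SpecialLinearGroup.coe_one, Matrix.vecMul_one]
  mul_mem' := by
    intro γ δ hγ hδ i hi
    rw [map_mul, Matrix.SpecialLinearGroup.coe_mul, ← Matrix.vecMul_vecMul, hγ i hi, hδ i hi]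
  inv_mem' := by
    intro γ hγ i hi
    conv_lhs => rw [← hγ i hi]
    rw [Matrix.vecMul_vecMul, ← Matrix.SpecialLinearGroup.coe_mul, ← map_mul, mul_inv_cancel, map_one,
      Matrix.SpecialLinearGroup.coe_one, Matrix.vecMul_one]

variable {n N} in
/-- Unfolding lemma for `Gamma1`. [folklore] -/
theorem mem_Gamma1_def {γ : SL(n, ℤ)} :
    γ ∈ Gamma1 n N ↔ ∀ i : Fin n, (i : ℕ) + 1 = n →
      Pi.single i (1 : ZMod N) ᵥ* (reduceMod n N γ : Matrix (Fin n) (Fin n) (ZMod N)) =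
        Pi.single i (1 : ZMod N) :=
  Iff.rfl

variable {n N} in
/-- `γ ∈ Γ₁(N)` iff its last row is `≡ (0, …, 0, 1) (mod N)`. [folklore] -/
theorem mem_Gamma1_iff {γ : SL(n, ℤ)} :
    γ ∈ Gamma1 n N ↔
      ∀ i : Fin n, (i : ℕ) + 1 = n → ∀ j : Fin n,
        ((γ i j : ℤ) : ZMod N) = if j = i then 1 else 0 := by
  rw [mem_Gamma1_def]
  refine forall_congr' fun i => forall_congr' fun _ => ?_
  rw [Matrix.single_one_vecMul, funext_iff]
  refine forall_congr' fun j => ?_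
  rw [Matrix.row_apply, Pi.single_apply]
  rfl

/-- `Γ₁(N) ≤ Γ₀(N)`. [folklore] -/
theorem Gamma1_le_Gamma0 : Gamma1 n N ≤ Gamma0 n N := fun _ hγ i hi =>
  ⟨1, by rw [one_smul]; exact hγ i hi⟩

/-- For `n = 2`, `Γ₀(N)` is Mathlib's `CongruenceSubgroup.Gamma0 N` (lower-left entry `≡ 0`).
[folklore] -/
theorem Gamma0_two (N : ℕ) : Gamma0 2 N = CongruenceSubgroup.Gamma0 N := by
  ext γ
  rw [mem_Gamma0_iff, CongruenceSubgroup.Gamma0_mem]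
  constructor
  · intro h
    exact h 1 rfl 0 (by decide)
  · intro h i hi j hj
    fin_cases i
    · simp at hi
    · fin_cases j
      · exact h
      · exact absurd rfl hj

/-- For `n = 2`, `Γ₁(N)` is Mathlib's `CongruenceSubgroup.Gamma1 N` (`c ≡ 0`, `a ≡ d ≡ 1`; the
condition `a ≡ 1` follows from `det = 1`). [folklore] -/
theorem Gamma1_two (N : ℕ) : Gamma1 2 N = CongruenceSubgroup.Gamma1 N := by
  ext γ
  rw [mem_Gamma1_iff, CongruenceSubgroup.Gamma1_mem]
  constructor
  · intro h
    have h10 : ((γ 1 0 : ℤ) : ZMod N) = 0 := by simpa using h 1 rfl 0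
    have h11 : ((γ 1 1 : ℤ) : ZMod N) = 1 := by simpa using h 1 rfl 1
    have hdet := Matrix.SpecialLinearGroup.det_coe γ
    rw [Matrix.det_fin_two] at hdet
    have hdet' := congrArg (Int.cast : ℤ → ZMod N) hdet
    push_cast at hdet'
    rw [h10, h11, mul_one, mul_zero, sub_zero] at hdet'
    exact ⟨hdet', h11, h10⟩
  · rintro ⟨_, h11, h10⟩ i hi j
    fin_cases i
    · simp at hi
    · fin_cases j
      · simpa using h10
      · simpa using h11

end Level

/-! ### The Hecke module `H^i(Γ, A)` and the operators `T_g`, `g ∈ GL_n(ℚ)` -/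

section Hecke

variable (n : ℕ)

/-- `SL_n(ℤ) →* GL_n(ℚ)` (Mathlib `Matrix.SpecialLinearGroup.mapGL`). [folklore] -/
abbrev toGLQ : SL(n, ℤ) →* GL (Fin n) ℚ :=
  Matrix.SpecialLinearGroup.mapGL ℚ

/-- A subgroup `Γ ≤ SL_n(ℤ)` viewed as a subgroup of `GL_n(ℚ)` (the "level"). [folklore] -/
abbrev levelGL (Γ : Subgroup SL(n, ℤ)) : Subgroup (GL (Fin n) ℚ) :=
  Γ.map (toGLQ n)

/-- **`H^i(Γ, A)`** for `Γ ≤ SL_n(ℤ)` and a commutative ring `A` of (trivial) coefficients, typed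
as the tree's cohomology of the arithmetic quotient of level `Γ` for the group `GL_n(ℚ)` acting on
itself: `H^i(GL_n(ℚ), Fun(GL_n(ℚ) ⧸ Γ, A))` (`ArithmeticQuotient.cohomology`, Mathlib
`groupCohomology`), which is `H^i(Γ, A)` by Shapiro's lemma (the coefficients are the co-induced
module of the trivial `Γ`-module `A`; Mathlib `groupCohomology.coindIso`).  This is the Hecke
module `V = H^*(Γ₀(N), M)`, `M = A` trivial, of [AshGunnellsMcconnell2011, §3, Conj. 5(b)], in
the form on which double cosets act without restriction/corestriction (module docstring).
[cite: AshGunnellsMcconnell2011, §3; Scholze2015, §V.4] -/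
abbrev cohomology (Γ : Subgroup SL(n, ℤ)) (A : Type) [CommRing A] (i : ℕ) : ModuleCat A :=
  ArithmeticQuotient.cohomology A (MonoidHom.id (GL (Fin n) ℚ)) (levelGL n Γ) A i

/-- **The Hecke operator `T_g = [Γ g Γ]`**, `g ∈ GL_n(ℚ)`, on `H^i(Γ, A)`: the tree's
`ArithmeticQuotient.heckeEnd`, induced from `(T_g f)(xΓ) = ∑_{hΓ ⊆ Γ g Γ} f(x h Γ)` on
`Fun(GL_n(ℚ) ⧸ Γ, A)`; equivalently `cores ∘ (g·)_* ∘ res` through `Γ ∩ g⁻¹Γg → Γ ∩ gΓg⁻¹` ("twisted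
restriction followed by corestriction" [AshGunnellsMcconnell2011, §2], coefficients acted on from the
left), and `(T_g F)(y) = ∑_{Γβ ⊆ Γ g⁻¹ Γ} F(β y)` on invariant functions, i.e. `τ_{g⁻¹}` for the
double coset operator `τ_α = [ΓαΓ]` of modular forms [DiamondShurman2005, Def. 5.1.3] (module
docstring, where the `k ↔ n-k` ambiguity between this and the adjoint-of-homology reading is spelled
out). [cite: AshGunnellsMcconnell2011, §2–§3; DiamondShurman2005, Def. 5.1.3] -/
abbrev heckeOp (Γ : Subgroup SL(n, ℤ)) (A : Type) [CommRing A] (i : ℕ) (g : GL (Fin n) ℚ) :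
    Module.End A (cohomology n Γ A i) :=
  ArithmeticQuotient.heckeEnd A (levelGL n Γ) g A (MonoidHom.id (GL (Fin n) ℚ)) i

/-- The unit `ℓ ∈ ℚ^×` of a natural number `ℓ ≠ 0` (junk value `1` at `ℓ = 0`). [folklore] -/
def natUnit (ℓ : ℕ) : ℚˣ :=
  if h : ℓ = 0 then 1 else Units.mk0 (ℓ : ℚ) (Nat.cast_ne_zero.mpr h)

/-- `natUnit ℓ = ℓ` in `ℚ` for `ℓ ≠ 0`. [folklore] -/
@[simp]
theorem coe_natUnit {ℓ : ℕ} (h : ℓ ≠ 0) : (natUnit ℓ : ℚ) = ℓ := by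
  simp [natUnit, h]

/-- Diagonal invertible matrices `(Fin n → ℚ^×) →* GL_n(ℚ)` (Mathlib `Matrix.diagonalRingHom`,
`Units.map`, `MulEquiv.piUnits`; same construction as the tree's adelic `glDiagonal`). [folklore] -/
def diagGL : (Fin n → ℚˣ) →* GL (Fin n) ℚ :=
  (Units.map (Matrix.diagonalRingHom (Fin n) ℚ).toMonoidHom).comp
    (MulEquiv.piUnits (M := fun _ : Fin n => ℚ)).symm.toMonoidHom

/-- The underlying matrix of `diagGL d` is `diagonal d`. [folklore] -/
@[simp]
theorem coe_diagGL (d : Fin n → ℚˣ) :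
    (diagGL n d : Matrix (Fin n) (Fin n) ℚ) = Matrix.diagonal fun j => (d j : ℚ) :=
  rfl

/-- **The Hecke matrix `E(ℓ, k) = diag(ℓ, …, ℓ, 1, …, 1) ∈ GL_n(ℚ)`** with `k` entries `ℓ` in the
FIRST `k` diagonal slots (for `k ≥ n`: `ℓ · 1`).  It has the elementary divisors of
`D(ℓ,k) = diag(1,…,1,ℓ,…,ℓ)` of [AshGunnellsMcconnell2011, §3] and is the representative used by the
tree's `Ash2003.heckeElement` / `heckeDiagAt`; for `k < n` its last row is `(0,…,0,1)`, so it lies in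
the Hecke semigroup of `Γ₁(N)`. [cite: AshGunnellsMcconnell2011, §3 (D(ℓ,k))] -/
def heckeMatrix (ℓ k : ℕ) : GL (Fin n) ℚ :=
  diagGL n fun j => if j.val < k then natUnit ℓ else 1

/-- Entries of `E(ℓ,k)`: `ℓ` on the first `k` diagonal slots, `1` on the others, `0` off the
diagonal (`ℓ ≠ 0`). [folklore] -/
theorem heckeMatrix_apply {ℓ : ℕ} (hℓ : ℓ ≠ 0) (k : ℕ) (i j : Fin n) :
    (heckeMatrix n ℓ k : Matrix (Fin n) (Fin n) ℚ) i j =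
      if i = j then (if i.val < k then (ℓ : ℚ) else 1) else 0 := by
  rw [heckeMatrix, coe_diagGL, Matrix.diagonal_apply]
  split_ifs <;> simp [hℓ]

/-- `E(ℓ, 0) = 1`. [folklore] -/
@[simp]
theorem heckeMatrix_zero (ℓ : ℕ) : heckeMatrix n ℓ 0 = 1 := by
  refine Matrix.GeneralLinearGroup.ext fun i j => ?_
  simp [heckeMatrix]

/-- **The Hecke operator `T(ℓ, k) = [Γ E(ℓ,k) Γ] = T_{E(ℓ,k)}`** on `H^i(Γ, A)` (`heckeOp` of
`heckeMatrix`): the operator `T(ℓ,k)` of [AshGunnellsMcconnell2011, §3] (`Γ = Γ₀(N)` or `Γ₁(N)`,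
`ℓ ∤ N` prime, `0 ≤ k ≤ n`) in the conventions fixed in the module docstring (representative with the
`ℓ`'s first; left-coefficient reading of the double coset action; for `n = 2`, `T(p,1)` is the `T_p`
of [DiamondShurman2005, §5.2]). [cite: AshGunnellsMcconnell2011, §3; DiamondShurman2005, §5.2] -/
abbrev heckeT (Γ : Subgroup SL(n, ℤ)) (A : Type) [CommRing A] (i : ℕ) (ℓ k : ℕ) :
    Module.End A (cohomology n Γ A i) :=
  heckeOp n Γ A i (heckeMatrix n ℓ k)

/-- `T(ℓ, 0) = [Γ 1 Γ]` is the identity. [folklore] -/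
theorem heckeT_zero (Γ : Subgroup SL(n, ℤ)) (A : Type) [CommRing A] (i : ℕ) (ℓ : ℕ) :
    heckeT n Γ A i ℓ 0 = LinearMap.id := by
  have h1 : ArithmeticQuotient.heckeRepHom A (levelGL n Γ) (heckeMatrix n ℓ 0) A
      (MonoidHom.id (GL (Fin n) ℚ)) = 𝟙 _ := by
    refine Rep.hom_ext (Representation.IntertwiningMap.ext (LinearMap.ext fun f => ?_))
    change ArithmeticQuotient.heckeFun A (levelGL n Γ) (heckeMatrix n ℓ 0) A f = f
    rw [heckeMatrix_zero, ArithmeticQuotient.heckeFun_one, LinearMap.id_apply]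
  change (groupCohomology.map (MonoidHom.id _) _ i).hom = _
  rw [h1, groupCohomology.map_id]
  rfl

variable (N : ℕ)

/-- A representative `γ_d ∈ Γ₀(N)` of `d ∈ ℤ/Nℤ` under `Γ₀(N)/Γ₁(N) → (ℤ/N)`, `γ ↦ γ_{nn}`: an element
of `Γ₀(N)` whose lower-right entry is `≡ d (mod N)`, chosen by `Classical.epsilon` (junk when none
exists, e.g. `d` not a unit, or `n ≤ 1` and `d ≠ 1`); for `n = 2` this is the matrix
`(a b; c δ) ∈ Γ₀(N)`, `δ ≡ d`, defining `⟨d⟩` in [DiamondShurman2005, §5.2].  Any two choices differ by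
`Γ₁(N)` (`SLn.inv_mul_mem_Gamma1`), so the operator `diamondOp` below does not depend on the choice
(`SLn.diamondOp_eq_heckeOp`). [cite: DiamondShurman2005, §5.2] -/
def diamondRep (d : ZMod N) : SL(n, ℤ) :=
  Classical.epsilon fun γ : SL(n, ℤ) =>
    γ ∈ Gamma0 n N ∧ ∀ i : Fin n, (i : ℕ) + 1 = n → ((γ i i : ℤ) : ZMod N) = d

variable {n N} in
/-- When a representative exists, `diamondRep` is one. [folklore] -/
theorem diamondRep_spec {d : ZMod N}
    (h : ∃ γ : SL(n, ℤ), γ ∈ Gamma0 n N ∧ ∀ i : Fin n, (i : ℕ) + 1 = n → ((γ i i : ℤ) : ZMod N) = d) :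
    diamondRep n N d ∈ Gamma0 n N ∧
      ∀ i : Fin n, (i : ℕ) + 1 = n → ((diamondRep n N d i i : ℤ) : ZMod N) = d :=
  Classical.epsilon_spec h

/-- The block matrix `1_m ⊕ (u, -v; N, a) ∈ SL_{m+2}(ℤ)` for `u a + v N = 1`: an element of `Γ₀(N)`
with lower-right entry `a` (`SLn.exists_diamondRep`). [folklore] -/
def diamondBlock (m N : ℕ) (a u v : ℤ) (h : u * a + v * N = 1) : SL(m + 2, ℤ) :=
  ⟨Matrix.reindex finSumFinEquiv finSumFinEquiv
      (Matrix.fromBlocks (1 : Matrix (Fin m) (Fin m) ℤ) 0 0 !![u, -v; (N : ℤ), a]), by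
    rw [Matrix.det_reindex_self, Matrix.det_fromBlocks_zero₂₁, Matrix.det_one, one_mul,
      Matrix.det_fin_two_of]
    linear_combination h⟩

/-- Entries of `diamondBlock`. [folklore] -/
theorem diamondBlock_apply (m N : ℕ) (a u v : ℤ) (h : u * a + v * N = 1) (i j : Fin (m + 2)) :
    diamondBlock m N a u v h i j =
      Matrix.fromBlocks (1 : Matrix (Fin m) (Fin m) ℤ) 0 0 !![u, -v; (N : ℤ), a]
        (finSumFinEquiv.symm i) (finSumFinEquiv.symm j) :=
  rfl

/-- **Diamond representatives exist for `n ≥ 2`**: for every unit `d ∈ (ℤ/N)^×` there is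
`γ ∈ Γ₀(N) ≤ SL_{m+2}(ℤ)` with lower-right entry `≡ d` (Bezout: `γ = 1_m ⊕ (u, -v; N, a)`,
`a ≡ d`, `u a + v N = 1`), so that `Γ₀(N)/Γ₁(N) ≅ (ℤ/N)^×`. [folklore] -/
theorem exists_diamondRep (m N : ℕ) (d : (ZMod N)ˣ) :
    ∃ γ : SL(m + 2, ℤ), γ ∈ Gamma0 (m + 2) N ∧
      ∀ i : Fin (m + 2), (i : ℕ) + 1 = m + 2 → ((γ i i : ℤ) : ZMod N) = d := by
  set a : ℤ := ZMod.cast (d : ZMod N) with ha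
  have had : (a : ZMod N) = d := ZMod.intCast_zmod_cast _
  have hunit : IsUnit (a : ZMod N) := by rw [had]; exact Units.isUnit d
  obtain ⟨v, u, huv⟩ := (ZMod.coe_int_isUnit_iff_isCoprime a N).mp hunit
  have hlast : ∀ i : Fin (m + 2), (i : ℕ) + 1 = m + 2 → i = Fin.natAdd m (1 : Fin 2) := by
    intro i hi
    refine Fin.ext ?_
    change (i : ℕ) = m + 1
    omega
  refine ⟨diamondBlock m N a u v (by linear_combination huv), ?_, ?_⟩
  · rw [mem_Gamma0_iff]
    intro i hi j hj
    obtain rfl := hlast i hi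
    obtain ⟨x, rfl⟩ := finSumFinEquiv.surjective j
    rcases x with j' | j'
    · simp [diamondBlock_apply]
    · fin_cases j'
      · simp [diamondBlock_apply]
      · exact absurd rfl hj
  · intro i hi
    obtain rfl := hlast i hi
    simpa [diamondBlock_apply] using had

/-- For `n = m + 2` and a unit `d`, `diamondRep` is a genuine representative: it lies in `Γ₀(N)` and
its lower-right entry is `≡ d`. [folklore] -/
theorem diamondRep_mem (m N : ℕ) (d : (ZMod N)ˣ) :
    diamondRep (m + 2) N (d : ZMod N) ∈ Gamma0 (m + 2) N ∧
      ∀ i : Fin (m + 2), (i : ℕ) + 1 = m + 2 →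
        ((diamondRep (m + 2) N (d : ZMod N) i i : ℤ) : ZMod N) = d :=
  diamondRep_spec (exists_diamondRep m N d)

variable {n N} in
/-- For `γ ∈ Γ₀(N)` the last row reduces to `γ_{nn} e_n`: `e_n γ ≡ γ_{nn} e_n (mod N)`. [folklore] -/
theorem single_vecMul_of_mem_Gamma0 {γ : SL(n, ℤ)} (hγ : γ ∈ Gamma0 n N) {i : Fin n}
    (hi : (i : ℕ) + 1 = n) :
    Pi.single i (1 : ZMod N) ᵥ* (reduceMod n N γ : Matrix (Fin n) (Fin n) (ZMod N)) =
      ((γ i i : ℤ) : ZMod N) • Pi.single i (1 : ZMod N) := by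
  obtain ⟨u, hu⟩ := hγ i hi
  have hii : ((γ i i : ℤ) : ZMod N) = u := by
    have := congrFun hu i
    rw [Matrix.single_one_vecMul, Matrix.row_apply, Pi.smul_apply, Pi.single_eq_same, smul_eq_mul,
      mul_one] at this
    exact this
  rw [hii, hu]

variable {n N} in
/-- Two elements of `Γ₀(N)` with the same lower-right entry modulo `N`, a unit, differ by `Γ₁(N)`:
`γ'⁻¹ γ ∈ Γ₁(N)`. [folklore] -/
theorem inv_mul_mem_Gamma1 {γ γ' : SL(n, ℤ)} (hγ : γ ∈ Gamma0 n N) (hγ' : γ' ∈ Gamma0 n N)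
    (d : (ZMod N)ˣ) (hd : ∀ i : Fin n, (i : ℕ) + 1 = n → ((γ i i : ℤ) : ZMod N) = d)
    (hd' : ∀ i : Fin n, (i : ℕ) + 1 = n → ((γ' i i : ℤ) : ZMod N) = d) :
    γ'⁻¹ * γ ∈ Gamma1 n N := by
  intro i hi
  have h1 := single_vecMul_of_mem_Gamma0 hγ hi
  have h2 := single_vecMul_of_mem_Gamma0 hγ' hi
  rw [hd i hi] at h1
  rw [hd' i hi] at h2
  -- `e γ'⁻¹ = d⁻¹ e`
  have h3 : Pi.single i (1 : ZMod N) ᵥ* (reduceMod n N γ'⁻¹ : Matrix (Fin n) (Fin n) (ZMod N)) =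
      ((d⁻¹ : (ZMod N)ˣ) : ZMod N) • Pi.single i (1 : ZMod N) := by
    have h4 : (d : ZMod N) • (Pi.single i (1 : ZMod N) ᵥ*
        (reduceMod n N γ'⁻¹ : Matrix (Fin n) (Fin n) (ZMod N))) = Pi.single i 1 := by
      rw [← Matrix.smul_vecMul, ← h2, Matrix.vecMul_vecMul, ← Matrix.SpecialLinearGroup.coe_mul,
        ← map_mul, mul_inv_cancel, map_one, Matrix.SpecialLinearGroup.coe_one, Matrix.vecMul_one]
    calc Pi.single i (1 : ZMod N) ᵥ* (reduceMod n N γ'⁻¹ : Matrix (Fin n) (Fin n) (ZMod N))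
        = (((d⁻¹ : (ZMod N)ˣ) : ZMod N) * (d : ZMod N)) • (Pi.single i (1 : ZMod N) ᵥ*
            (reduceMod n N γ'⁻¹ : Matrix (Fin n) (Fin n) (ZMod N))) := by
          rw [Units.inv_mul, one_smul]
      _ = ((d⁻¹ : (ZMod N)ˣ) : ZMod N) • ((d : ZMod N) • (Pi.single i (1 : ZMod N) ᵥ*
            (reduceMod n N γ'⁻¹ : Matrix (Fin n) (Fin n) (ZMod N)))) := by rw [smul_smul]
      _ = ((d⁻¹ : (ZMod N)ˣ) : ZMod N) • Pi.single i (1 : ZMod N) := by rw [h4]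
  rw [map_mul, Matrix.SpecialLinearGroup.coe_mul, ← Matrix.vecMul_vecMul, h3, Matrix.smul_vecMul, h1,
    smul_smul, Units.inv_mul, one_smul]

/-- **Independence of the representative.** For `n = m + 2`, a unit `d` and ANY `γ ∈ Γ₀(N)` with
lower-right entry `≡ d`, the diamond operator `⟨d⟩` (defined through the chosen `γ_d`) equals
`T_{γ⁻¹}`: `Γ₁(N) γ_d⁻¹ Γ₁(N) = Γ₁(N) γ⁻¹ Γ₁(N)`. [folklore] -/
theorem diamondOp_eq_heckeOp (m N : ℕ) (A : Type) [CommRing A] (i : ℕ) (d : (ZMod N)ˣ)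
    {γ : SL(m + 2, ℤ)} (hγ : γ ∈ Gamma0 (m + 2) N)
    (hd : ∀ j : Fin (m + 2), (j : ℕ) + 1 = m + 2 → ((γ j j : ℤ) : ZMod N) = d) :
    heckeOp (m + 2) (Gamma1 (m + 2) N) A i (toGLQ (m + 2) (diamondRep (m + 2) N (d : ZMod N)))⁻¹ =
      heckeOp (m + 2) (Gamma1 (m + 2) N) A i (toGLQ (m + 2) γ)⁻¹ := by
  obtain ⟨hγd, hdd⟩ := diamondRep_mem m N d
  set γd := diamondRep (m + 2) N (d : ZMod N) with hγd_def
  have hmem : toGLQ (m + 2) (γd⁻¹ * γ) ∈ levelGL (m + 2) (Gamma1 (m + 2) N) :=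
    Subgroup.mem_map_of_mem _ (inv_mul_mem_Gamma1 hγ hγd d hd hdd)
  have heq : (toGLQ (m + 2) γd)⁻¹ =
      ((⟨_, hmem⟩ : levelGL (m + 2) (Gamma1 (m + 2) N)) : GL (Fin (m + 2)) ℚ) * (toGLQ (m + 2) γ)⁻¹ *
        ((1 : levelGL (m + 2) (Gamma1 (m + 2) N)) : GL (Fin (m + 2)) ℚ) := by
    show (toGLQ (m + 2) γd)⁻¹ = toGLQ (m + 2) (γd⁻¹ * γ) * (toGLQ (m + 2) γ)⁻¹ * 1
    rw [mul_one, map_mul, map_inv, mul_assoc, mul_inv_cancel, mul_one]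
  rw [heckeOp, heq]
  exact ArithmeticQuotient.heckeEnd_coe_mul_mul_coe A (levelGL (m + 2) (Gamma1 (m + 2) N)) A
    (MonoidHom.id _) _ _ _ i

/-- **The diamond operator `⟨d⟩ = [Γ₁(N) γ_d⁻¹ Γ₁(N)] = T_{γ_d⁻¹}`** on `H^i(Γ₁(N), A)`,
`d ∈ ℤ/Nℤ` (meaningful for `d` a unit and `n ≥ 2`): right translation by `γ_d⁻¹` on `GL_n(ℚ) ⧸ Γ₁(N)`,
`(⟨d⟩ f)(xΓ₁) = f(x γ_d⁻¹ Γ₁)`, i.e. `F ↦ F(γ_d ·)` on `Γ₁(N)`-invariant functions — the action of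
`Γ₀(N)/Γ₁(N) ≅ (ℤ/N)^×` which for `n = 2` is `⟨d⟩ f = f[α]_k` (`α ∈ Γ₀(N)`, lower-right entry `≡ d`)
of [DiamondShurman2005, §5.2] (module docstring: `T_g = τ_{g⁻¹}`). [cite: DiamondShurman2005, §5.2] -/
abbrev diamondOp (A : Type) [CommRing A] (i : ℕ) (d : ZMod N) :
    Module.End A (cohomology n (Gamma1 n N) A i) :=
  heckeOp n (Gamma1 n N) A i (toGLQ n (diamondRep n N d))⁻¹

end Hecke

/-! ### Faithful vectors -/

section Faithful

/-- Over a field a vector is faithful (`r • c = 0 → r = 0`) iff it is non-zero. [folklore] -/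
theorem faithful_iff_ne_zero {K V : Type*} [Field K] [AddCommGroup V] [Module K V] {c : V} :
    (∀ r : K, r • c = 0 → r = 0) ↔ c ≠ 0 := by
  constructor
  · intro h hc
    exact one_ne_zero (h 1 (by rw [hc, smul_zero]))
  · intro hc r hr
    by_contra hr0
    exact hc (by simpa [hr0] using hr)

/-- A faithful vector over a non-trivial ring is non-zero. [folklore] -/
theorem ne_zero_of_faithful {R V : Type*} [Ring R] [Nontrivial R] [AddCommGroup V] [Module R V]
    {c : V} (h : ∀ r : R, r • c = 0 → r = 0) : c ≠ 0 := fun hc =>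
  one_ne_zero (h 1 (by rw [hc, smul_zero]))

end Faithful

end SLn

/-! ### Torsion Hecke eigensystems (Ash–Gunnells–McConnell, Definition 4) -/

section Eigensystem

variable (n N : ℕ) (A : Type) [CommRing A] (i : ℕ) (S : Finset ℕ)

/-- **A Hecke eigensystem with values in `A` occurring in `H^i(Γ₁(N) ⊂ SL_n(ℤ), A)`**
([AshGunnellsMcconnell2011, §3, Definition 4], first half, for the Hecke module
`V = H^i(Γ₁(N), A)` with trivial coefficients `A`, e.g. `A = ℤ/p^mℤ` or `𝒪/ϖ^m`): a class
`c ∈ H^i(Γ₁(N), A)` (`SLn.cohomology`) which is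

* **faithful**: `r • c = 0 → r = 0` for `r ∈ A` (for a field `A` this is `c ≠ 0`, the source's
  "eigenvector", `SLn.faithful_iff_ne_zero`; for `A = ℤ/p^m` it says `c` has exact order `p^m`, which
  is what makes its eigenvalues well defined in `ℤ/p^m` rather than only modulo `p` — see the
  module docstring);
* a simultaneous eigenclass of the operators `T(ℓ, k) = [Γ₁(N) diag(ℓ^{(k)}, 1^{(n-k)}) Γ₁(N)]`
  (`SLn.heckeT`) with eigenvalues `a ℓ k ∈ A`, for every prime `ℓ ∤ N` outside the finite set `S` of
  neglected primes (`S = ∅` in the source; `S = {p}` is customary for `A` of characteristic `p`) and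
  every `0 ≤ k ≤ n`;
* an eigenclass of the diamond operators `⟨d⟩`, `d ∈ (ℤ/N)^×` (`SLn.diamondOp`), with eigenvalues
  (nebentype) `ε d` — for `Γ₁(N)` these carry the part of the source's `T(ℓ, n)` for `Γ₀(N)` that is
  not in `[Γ₁(N) ℓ·1 Γ₁(N)]` (module docstring).

The values `a ℓ k` for `ℓ ∈ S`, `ℓ ∣ N`, `ℓ` not prime or `k > n` are not constrained.
[cite: AshGunnellsMcconnell2011, §3, Definition 4] -/
structure TorsionHeckeEigensystem where
  /-- The eigenclass `c ∈ H^i(Γ₁(N), A)`. -/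
  cl : SLn.cohomology n (SLn.Gamma1 n N) A i
  /-- `c` is faithful: its annihilator in `A` is zero. -/
  faithful : ∀ r : A, r • cl = 0 → r = 0
  /-- The eigenvalues `a ℓ k` of `T(ℓ, k)`. -/
  a : ℕ → ℕ → A
  /-- The nebentype: the eigenvalues of the diamond operators. -/
  ε : (ZMod N)ˣ → A
  /-- `T(ℓ, k) c = a(ℓ, k) • c` for primes `ℓ ∤ N`, `ℓ ∉ S`, and `0 ≤ k ≤ n`. -/
  eigen : ∀ ℓ : ℕ, ℓ.Prime → ℓ ∉ S → ¬ ℓ ∣ N → ∀ k ≤ n,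
    SLn.heckeT n (SLn.Gamma1 n N) A i ℓ k cl = a ℓ k • cl
  /-- `⟨d⟩ c = ε(d) • c` for `d ∈ (ℤ/N)^×`. -/
  nebentype : ∀ d : (ZMod N)ˣ, SLn.diamondOp n N A i (d : ZMod N) cl = ε d • cl

/-- **The `A`-valued Hecke eigensystem `(a, ε)` occurs in `H^i(Γ₁(N) ⊂ SL_n(ℤ), A)`** (away from
the primes in `S`): there is a faithful class `c ∈ H^i(Γ₁(N), A)` with `T(ℓ,k) c = a(ℓ,k) • c` for all
primes `ℓ ∤ N`, `ℓ ∉ S`, all `0 ≤ k ≤ n`, and `⟨d⟩ c = ε(d) • c` for `d ∈ (ℤ/N)^×`; i.e.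
`TorsionHeckeEigensystem n N A i S` with these values is inhabited
(`TorsionHeckeEigensystem.occurs_iff`).  With `A = ℤ/p^mℤ` this is the statement "the system of
Hecke eigenvalues `a` is present modulo `p^m` in `H^i(Γ₁(N), ℤ/p^m)`" in the sense of
[AshGunnellsMcconnell2011, §3, Def. 4] (eigenvector sense, with the faithfulness proviso of the
module docstring). [cite: AshGunnellsMcconnell2011, §3, Definition 4] -/
def TorsionHeckeEigensystem.Occurs (a : ℕ → ℕ → A) (ε : (ZMod N)ˣ → A) : Prop :=
  ∃ c : SLn.cohomology n (SLn.Gamma1 n N) A i,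
    (∀ r : A, r • c = 0 → r = 0) ∧
    (∀ ℓ : ℕ, ℓ.Prime → ℓ ∉ S → ¬ ℓ ∣ N → ∀ k ≤ n,
      SLn.heckeT n (SLn.Gamma1 n N) A i ℓ k c = a ℓ k • c) ∧
    (∀ d : (ZMod N)ˣ, SLn.diamondOp n N A i (d : ZMod N) c = ε d • c)

namespace TorsionHeckeEigensystem

variable {n N A i S}

/-- The eigensystem of a `TorsionHeckeEigensystem` occurs. [folklore] -/
theorem occurs (E : TorsionHeckeEigensystem n N A i S) : Occurs n N A i S E.a E.ε :=
  ⟨E.cl, E.faithful, E.eigen, E.nebentype⟩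

/-- `Occurs a ε` iff some `TorsionHeckeEigensystem` has values `(a, ε)`. [folklore] -/
theorem occurs_iff {a : ℕ → ℕ → A} {ε : (ZMod N)ˣ → A} :
    Occurs n N A i S a ε ↔ ∃ E : TorsionHeckeEigensystem n N A i S, E.a = a ∧ E.ε = ε := by
  constructor
  · rintro ⟨c, hf, he, hd⟩
    exact ⟨⟨c, hf, a, ε, he, hd⟩, rfl, rfl⟩
  · rintro ⟨E, rfl, rfl⟩
    exact E.occurs

/-- The eigenclass of a torsion Hecke eigensystem is non-zero (for `A ≠ 0`). [folklore] -/
theorem cl_ne_zero [Nontrivial A] (E : TorsionHeckeEigensystem n N A i S) : E.cl ≠ 0 :=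
  SLn.ne_zero_of_faithful E.faithful

/-- The eigenvalue of `T(ℓ, 0) = 1` on a faithful eigenclass is `a(ℓ, 0) = 1`. [folklore] -/
theorem a_zero (E : TorsionHeckeEigensystem n N A i S) {ℓ : ℕ} (hℓ : ℓ.Prime) (hS : ℓ ∉ S)
    (hN : ¬ ℓ ∣ N) : E.a ℓ 0 = 1 := by
  have h0 := E.eigen ℓ hℓ hS hN 0 (Nat.zero_le n)
  rw [SLn.heckeT_zero, LinearMap.id_apply] at h0
  have h2 : (E.a ℓ 0 - 1) • E.cl = 0 := by rw [sub_smul, one_smul, ← h0, sub_self]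
  exact sub_eq_zero.mp (E.faithful _ h2)

/-- Occurrence away from `S` implies occurrence away from any larger `S'`. [folklore] -/
theorem Occurs.mono {S S' : Finset ℕ} (hSS' : S ⊆ S') {a : ℕ → ℕ → A} {ε : (ZMod N)ˣ → A}
    (h : Occurs n N A i S a ε) : Occurs n N A i S' a ε := by
  obtain ⟨c, hf, he, hd⟩ := h
  exact ⟨c, hf, fun ℓ hℓ hS' hN k hk => he ℓ hℓ (fun hS => hS' (hSS' hS)) hN k hk, hd⟩

/-- An occurring eigensystem only matters through its values `a ℓ k` for primes `ℓ ∤ N`, `ℓ ∉ S`,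
`k ≤ n`, and through `ε`. [folklore] -/
theorem Occurs.congr {a b : ℕ → ℕ → A} {ε ε' : (ZMod N)ˣ → A}
    (hab : ∀ ℓ : ℕ, ℓ.Prime → ℓ ∉ S → ¬ ℓ ∣ N → ∀ k ≤ n, a ℓ k = b ℓ k) (hε : ∀ d, ε d = ε' d)
    (h : Occurs n N A i S a ε) : Occurs n N A i S b ε' := by
  obtain ⟨c, hf, he, hd⟩ := h
  exact ⟨c, hf, fun ℓ hℓ hS hN k hk => hab ℓ hℓ hS hN k hk ▸ he ℓ hℓ hS hN k hk,
    fun d => hε d ▸ hd d⟩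

/-- In an occurring eigensystem `a(ℓ, 0) = 1` for the relevant `ℓ`. [folklore] -/
theorem Occurs.apply_zero {a : ℕ → ℕ → A} {ε : (ZMod N)ˣ → A} (h : Occurs n N A i S a ε) {ℓ : ℕ}
    (hℓ : ℓ.Prime) (hS : ℓ ∉ S) (hN : ¬ ℓ ∣ N) : a ℓ 0 = 1 := by
  obtain ⟨E, rfl, rfl⟩ := occurs_iff.mp h
  exact E.a_zero hℓ hS hN

end TorsionHeckeEigensystem

end Eigensystem

end Literature.NumberTheory.Automorphic
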